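import Mathlib
import Literature.Probability.RandomPlanarGeometry.ChordalCurveFamilyProofs
import HarnessLib

/-!
# Strict extension of heads: a head of a curve is the class of a strictly longer head only across a pause

Crux `AxiomsOfLimit` (stmt-CriticalPhenomena-1370), line `registered`, stub `stub_markovOfLimit`: generic-level
no-grazing R2, piece (i) (lead c4); registered sub-stub `stub_strictExtension`. Theorems only.

For a curve `γ : Curve E` (`E` a metric space) and parameters `t₁ < t₂` in `[0, 1]`, if the heads
`γ ∘ affineClamp 0 t₁` and `γ ∘ affineClamp 0 t₂` (the pieces `γ|[0, t₁]`, `γ|[0, t₂]` traversed affinely) are at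
reparametrisation distance `0` — i.e. they define the same curve class — then `γ` is constant on `[t₁, t₂]`
(`Curve.apply_eq_of_dist_head_head_eq_zero`; planar instance `stub_strictExtension`). This is the rigidity
fact behind the left-continuity analysis of the pasts `s ↦ stopAt (cthickening s F)` of a limit curve.

Proof (variation count). For `ε > 0`, an *`ε`-chain of `γ` below `t`* is a monotone sequence of parameters
`s 0 ≤ s 1 ≤ … ≤ s k ≤ t` with `ε ≤ dist (γ (s i)) (γ (s (i + 1)))` for `i < k`.
* By uniform continuity of `γ` on `[0, 1]`, the length `k` of an `ε`-chain is bounded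
  (`StrictExtension.chain_length_le`).
* If the head up to `b` is at distance `< δ` from the head up to `a`, a sup-`δ`-close increasing
  reparametrisation carries `ε`-chains below `b` to `(ε - 2δ)`-chains below `a`
  (`StrictExtension.chain_transfer`).
* If `dist (γ u) (γ t₂) ≥ 2ε` for some `u ∈ (t₁, t₂)`, every `ε`-chain below `t₁` extends by one step (append
  `u` or `t₂`) to an `ε`-chain below `t₂` (`StrictExtension.chain_extend`).
Hence, if the two heads are at distance `0`, `γ t₁ = γ t₂` (equal targets) and some `u ∈ [t₁, t₂]` had
`m := dist (γ u) (γ t₂) > 0`, induction on `k` would produce `ε`-chains below `t₁` of every length `k` for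
every `ε < m / 2`, contradicting the length bound at `ε = m / 4`.

Sources: M. Aizenman, A. Burchard, Duke Math. J. 99 (1999) §2.1 (the curve space and its reparametrisation
pseudo-metric); the statement itself is folklore. All [folklore].
-/

noncomputable section

open Filter Topology Set Metric
open scoped unitInterval

namespace Summit.CriticalPhenomena.SAWScalingLimit.Theorems.AxiomsOfLimitMarkov

open Literature.Probability.RandomPlanarGeometry

section PseudoMetric

variable {E : Type*} [PseudoMetricSpace E]

/-- Pointwise formula for the head `γ ∘ affineClamp 0 t` of a curve up to the parameter `t : I`: it is
`s ↦ γ (t s)` (no clamping occurs). [folklore] -/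
theorem StrictExtension.head_apply (γ : Curve E) (t s : I) :
    (⟨γ.toContinuousMap.comp (Curve.affineClamp 0 t)⟩ : Curve E) s = γ (t * s) := by
  show (γ.toContinuousMap.comp (Curve.affineClamp 0 t)) s = _
  rw [ContinuousMap.comp_apply, Curve.affineClamp_apply, zero_add, Curve.coe_toContinuousMap,
    Set.projIcc_of_mem _ (unitInterval.mul_mem t.2 s.2)]
  rfl

/-- **Length bound for `ε`-chains.** By uniform continuity of a curve `c` on `[0, 1]` there is `δ > 0` such
that parameters at distance `< δ` have values at distance `< ε`; consecutive points of a monotone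
`ε`-chain are therefore `δ`-apart, so a chain with `k` steps forces `k δ ≤ 1`. [folklore] -/
theorem StrictExtension.chain_length_le (c : Curve E) {ε : ℝ} (hε : 0 < ε) :
    ∃ K : ℕ, ∀ (k : ℕ) (s : ℕ → I), Monotone s →
      (∀ i < k, ε ≤ dist (c (s i)) (c (s (i + 1)))) → k ≤ K := by
  obtain ⟨δ, hδ, hc⟩ := Metric.uniformContinuous_iff.1
    (CompactSpace.uniformContinuous_of_continuous c.continuous) ε hε
  refine ⟨⌊1 / δ⌋₊, fun k s hs hd => ?_⟩
  have step : ∀ i < k, (s i : ℝ) + δ ≤ s (i + 1) := fun i hi => by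
    by_contra h
    push Not at h
    have h1 : dist (s i) (s (i + 1)) < δ := by
      rw [Subtype.dist_eq, dist_comm, Real.dist_eq,
        abs_of_nonneg (sub_nonneg.2 (Subtype.coe_le_coe.2 (hs (Nat.le_succ i))))]
      linarith
    exact absurd (hc h1) (not_lt.2 (hd i hi))
  have key : ∀ i ≤ k, (s 0 : ℝ) + i * δ ≤ s i := by
    intro i
    induction i with
    | zero =>
      intro
      simp
    | succ n ih =>
      intro hn
      have h1 := ih (Nat.le_of_succ_le hn)
      have h2 := step n hn
      push_cast
      linarith
  have hk : (k : ℝ) * δ ≤ 1 := by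
    have h1 := key k le_rfl
    have h2 := unitInterval.nonneg (s 0)
    have h3 := unitInterval.le_one (s k)
    linarith
  exact Nat.le_floor ((le_div_iff₀ hδ).2 hk)

/-- **Transfer of `ε`-chains along close heads.** If the head of `γ` up to `b` is at reparametrisation
distance `< δ` from the head up to `a`, some increasing reparametrisation `φ` has
`dist (γ (b w)) (γ (a φ w)) < δ` for all `w`; writing the points of a monotone `ε`-chain below `b` as
`s i = b wᵢ`, the points `a φ wᵢ` form a monotone `(ε - 2δ)`-chain below `a`. [folklore] -/
theorem StrictExtension.chain_transfer (γ : Curve E) {a b : I} (hb : (0 : ℝ) < b) {δ ε : ℝ}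
    (hδ : dist (⟨γ.toContinuousMap.comp (Curve.affineClamp 0 b)⟩ : Curve E)
      ⟨γ.toContinuousMap.comp (Curve.affineClamp 0 a)⟩ < δ)
    {k : ℕ} {s : ℕ → I} (hs : Monotone s) (hsk : s k ≤ b)
    (hd : ∀ i < k, ε ≤ dist (γ (s i)) (γ (s (i + 1)))) :
    ∃ s' : ℕ → I, Monotone s' ∧ s' k ≤ a ∧
      ∀ i < k, ε - 2 * δ ≤ dist (γ (s' i)) (γ (s' (i + 1))) := by
  obtain ⟨φ, hφ⟩ := Curve.exists_dist_reparam_lt hδ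
  have hpt : ∀ w : I, dist (γ (b * w)) (γ (a * φ w)) < δ := fun w => by
    have h : dist ((⟨γ.toContinuousMap.comp (Curve.affineClamp 0 b)⟩ : Curve E) w)
        (((⟨γ.toContinuousMap.comp (Curve.affineClamp 0 a)⟩ : Curve E).reparam φ) w) < δ :=
      (ContinuousMap.dist_apply_le_dist w).trans_lt hφ
    rwa [Curve.reparam_apply, StrictExtension.head_apply, StrictExtension.head_apply] at h
  -- rescaled parameters `w i := s i / b ∈ [0, 1]`, so that `b * w i = s i` for `i ≤ k`
  obtain ⟨w, hw, hbw⟩ : ∃ w : ℕ → I, Monotone w ∧ ∀ i ≤ k, b * w i = s i := by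
    refine ⟨fun i => Set.projIcc 0 1 zero_le_one ((s i : ℝ) / b), fun i j hij =>
      Set.monotone_projIcc zero_le_one
        (div_le_div_of_nonneg_right (Subtype.coe_le_coe.2 (hs hij)) hb.le), fun i hi => ?_⟩
    have hsi : (s i : ℝ) ≤ b := Subtype.coe_le_coe.2 ((hs hi).trans hsk)
    apply Subtype.ext
    rw [Set.Icc.coe_mul]
    dsimp only
    rw [Set.projIcc_of_mem zero_le_one
      ⟨div_nonneg (unitInterval.nonneg _) hb.le, div_le_one_of_le₀ hsi hb.le⟩]
    field_simp
  refine ⟨fun i => a * φ (w i), fun i j hij => ?_, unitInterval.mul_le_left, fun i hi => ?_⟩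
  · exact Subtype.coe_le_coe.1 (by
      rw [Set.Icc.coe_mul, Set.Icc.coe_mul]
      exact mul_le_mul_of_nonneg_left (Subtype.coe_le_coe.2 (φ.monotone (hw hij)))
        (unitInterval.nonneg a))
  · have h1 := hpt (w i)
    have h2 := hpt (w (i + 1))
    rw [hbw i hi.le] at h1
    rw [hbw (i + 1) hi, dist_comm] at h2
    have h3 := hd i hi
    have h4 := dist_triangle4 (γ (s i)) (γ (a * φ (w i))) (γ (a * φ (w (i + 1)))) (γ (s (i + 1)))
    dsimp only
    linarith

/-- **One-step extension of `ε`-chains.** If `t₁ < u < t₂` and `2ε ≤ dist (γ u) (γ t₂)`, a monotone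
`ε`-chain of `γ` below `t₁` extends to a monotone `ε`-chain below `t₂` with one more step: its last value is
`ε`-far from `γ u` or from `γ t₂`, so append `u` or `t₂`. [folklore] -/
theorem StrictExtension.chain_extend (γ : Curve E) {t₁ u t₂ : I} (h₁ : t₁ < u) (h₂ : u < t₂) {ε : ℝ}
    (hε : 2 * ε ≤ dist (γ u) (γ t₂)) {k : ℕ} {s : ℕ → I} (hs : Monotone s) (hsk : s k ≤ t₁)
    (hd : ∀ i < k, ε ≤ dist (γ (s i)) (γ (s (i + 1)))) :
    ∃ s' : ℕ → I, Monotone s' ∧ s' (k + 1) ≤ t₂ ∧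
      ∀ i < k + 1, ε ≤ dist (γ (s' i)) (γ (s' (i + 1))) := by
  -- the new last point
  obtain ⟨v, hv, hvt, hdv⟩ : ∃ v : I, s k ≤ v ∧ v ≤ t₂ ∧ ε ≤ dist (γ (s k)) (γ v) := by
    by_cases h : ε ≤ dist (γ (s k)) (γ u)
    · exact ⟨u, (hsk.trans h₁.le), h₂.le, h⟩
    · refine ⟨t₂, hsk.trans (h₁.trans h₂).le, le_rfl, ?_⟩
      have h3 := dist_triangle (γ u) (γ (s k)) (γ t₂)
      rw [dist_comm (γ u) (γ (s k))] at h3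
      push Not at h
      linarith
  refine ⟨fun i => if i ≤ k then s i else v, ?_, ?_, ?_⟩
  · refine monotone_nat_of_le_succ fun i => ?_
    by_cases hi : i + 1 ≤ k
    · rw [if_pos (Nat.le_of_succ_le hi), if_pos hi]
      exact hs (Nat.le_succ i)
    · by_cases hi' : i ≤ k
      · rw [if_pos hi', if_neg hi, show i = k by omega]
        exact hv
      · rw [if_neg hi', if_neg hi]
  · dsimp only
    rw [if_neg (Nat.not_succ_le_self k)]
    exact hvt
  · intro i hi
    dsimp only
    rcases Nat.lt_or_ge i k with hik | hik
    · rw [if_pos hik.le, if_pos (Nat.succ_le_of_lt hik)]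
      exact hd i hik
    · have hik' : i = k := by omega
      subst hik'
      rw [if_pos le_rfl, if_neg (Nat.not_succ_le_self i)]
      exact hdv

end PseudoMetric

section Metric

variable {E : Type*} [MetricSpace E]

/-- **Strict extension of heads.** If `t₁ < t₂` and the heads `γ ∘ affineClamp 0 t₁`, `γ ∘ affineClamp 0 t₂`
of a curve `γ` in a metric space are at reparametrisation distance `0` (i.e. define the same curve class),
then `γ` is constant on `[t₁, t₂]`: a head cannot be the class of a strictly longer head unless the extra
piece is a pause. Proof by the variation count described in the module docstring. [folklore] -/
theorem Curve.apply_eq_of_dist_head_head_eq_zero (γ : Curve E) {t₁ t₂ : I} (hlt : t₁ < t₂)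
    (H : dist (⟨γ.toContinuousMap.comp (Curve.affineClamp 0 t₁)⟩ : Curve E)
      ⟨γ.toContinuousMap.comp (Curve.affineClamp 0 t₂)⟩ = 0)
    {u : I} (hu₁ : t₁ ≤ u) (hu₂ : u ≤ t₂) : γ u = γ t₂ := by
  by_contra hne
  set m : ℝ := dist (γ u) (γ t₂) with hm_def
  have hm : 0 < m := dist_pos.2 hne
  -- equal classes have equal targets: `γ t₁ = γ t₂`
  have ht : γ t₁ = γ t₂ := by
    have h := Curve.target_eq_of_dist_eq_zero H
    rwa [Curve.target_def, Curve.target_def, StrictExtension.head_apply,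
      StrictExtension.head_apply, mul_one, mul_one] at h
  have hu₁' : t₁ < u := lt_of_le_of_ne hu₁ fun h => hne (by rw [← h, ht])
  have hu₂' : u < t₂ := lt_of_le_of_ne hu₂ fun h => hne (by rw [h])
  have ht₂ : (0 : ℝ) < t₂ := (unitInterval.nonneg t₁).trans_lt (Subtype.coe_lt_coe.2 hlt)
  -- the length bound at `ε = m / 4`
  obtain ⟨K, hK⟩ := StrictExtension.chain_length_le γ (ε := m / 4) (by positivity)
  -- `ε`-chains below `t₁` of every length, for every `ε < m / 2`
  have claim : ∀ (j : ℕ) (ε : ℝ), ε < m / 2 →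
      ∃ s : ℕ → I, Monotone s ∧ s j ≤ t₁ ∧ ∀ i < j, ε ≤ dist (γ (s i)) (γ (s (i + 1))) := by
    intro j
    induction j with
    | zero =>
      exact fun ε _ => ⟨fun _ => t₁, monotone_const, le_rfl, fun i hi => absurd hi (Nat.not_lt_zero i)⟩
    | succ j ih =>
      intro ε hε
      obtain ⟨s, hs, hsj, hd⟩ := ih ((ε + m / 2) / 2) (by linarith)
      obtain ⟨s₂, hs₂, hs₂j, hd₂⟩ := StrictExtension.chain_extend γ hu₁' hu₂'
        (ε := (ε + m / 2) / 2) (by linarith) hs hsj hd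
      have hδ : dist (⟨γ.toContinuousMap.comp (Curve.affineClamp 0 t₂)⟩ : Curve E)
          ⟨γ.toContinuousMap.comp (Curve.affineClamp 0 t₁)⟩ < (m / 2 - ε) / 4 := by
        rw [dist_comm, H]
        linarith
      obtain ⟨s₃, hs₃, hs₃j, hd₃⟩ := StrictExtension.chain_transfer γ ht₂ hδ hs₂ hs₂j hd₂
      exact ⟨s₃, hs₃, hs₃j, fun i hi => by have := hd₃ i hi; linarith⟩
  obtain ⟨s, hs, -, hd⟩ := claim (K + 1) (m / 4) (by linarith)
  have := hK (K + 1) s hs hd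
  omega

end Metric

/-- Registered stub `stub_strictExtension` of crux `AxiomsOfLimit` (stmt-CriticalPhenomena-1370), line
`registered`: **strict extension of heads** for planar curves — if the heads `γ[0, t₁]`, `γ[0, t₂]` (`t₁ < t₂`) of
a curve `γ : Curve ℂ` are at reparametrisation distance `0` (the same curve class) then `γ` is constant on
`[t₁, t₂]`; the planar instance of `Curve.apply_eq_of_dist_head_head_eq_zero`. [folklore] -/
theorem stub_strictExtension : ∀ (γ : Literature.Probability.RandomPlanarGeometry.Curve ℂ) (t₁ t₂ : unitInterval), t₁ < t₂ → dist (⟨γ.toContinuousMap.comp (Literature.Probability.RandomPlanarGeometry.Curve.affineClamp 0 t₁)⟩ : Literature.Probability.RandomPlanarGeometry.Curve ℂ) ⟨γ.toContinuousMap.comp (Literature.Probability.RandomPlanarGeometry.Curve.affineClamp 0 t₂)⟩ = 0 → ∀ u : unitInterval, t₁ ≤ u → u ≤ t₂ → γ u = γ t₂ :=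
  fun γ _ _ hlt H _ hu₁ hu₂ => Curve.apply_eq_of_dist_head_head_eq_zero γ hlt H hu₁ hu₂

end Summit.CriticalPhenomena.SAWScalingLimit.Theorems.AxiomsOfLimitMarkov

end
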